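import Mathlib
import Summits.Ventures.LatticeQCDFlow.TrivializingMaps.AcceptanceFootprint
import Summits.Ventures.LatticeQCDFlow.TrivializingMaps.LightConeClustering
import HarnessLib

/-!
# THEOREM Q-ESS — the effective sample size of a strictly local flow bounds its footprint (theory-1 row 91)

HONEST FRAMING (verbatim, theory-1 brief): exact (Metropolis-corrected) sampling algorithms for lattice
gauge theory; figures of merit are autocorrelation/cost numbers at stated couplings and volumes; no
continuum-physics claim.

THEOREM Q (row 88) reads the ACCEPTANCE column of the leaderboard; this file reads the REWEIGHTING column.
A flow sampler used as an importance sampler reports the effective sample size; in population form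
`ESS/N → e := (∫ w dν)² / ∫ w² dν = 1 / ∫ w² dν` for the importance weight `w = dπ/dν` (`∫ w dν = 1`).  Write
`∫ w² dν ≤ 1 + χ` (`χ = 1/e - 1`).  The elementary inequality `|t| ≤ λt²/2 + 1/(2λ)` (`λ > 0`) integrated
against `ν` gives `∫ |p - q| dμ ≤ λχ/2 + 1/(2λ)`, i.e. DUAL CLOSENESS `IntegralClose(π, ν, λχ/2 + 1/(2λ))`
for every `λ > 0`, `= √χ` at `λ = 1/√χ` — no Cauchy–Schwarz machinery needed.  Row 88's covariance transfer
then gives, for a STRICTLY LOCAL proposal of range `r`: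

  `|Cov_π(A, B)| ≤ 3 √χ · a b = 3 √(1/e - 1) · a b`  for supports more than `2r` apart.

* §1 `abs_le_quad`; `integral_abs_sub_le_of_sqWeight`; `integralClose_of_sqWeight` (every `λ > 0`);
  `integralClose_of_sqWeight_sqrt` (`√χ`); `abs_cov_le_of_sqWeight` (`3 √χ a b` under exact model-side
  factorisation).
* §2 `abs_cov_le_of_sqWeight_of_disjoint` — product base law, push-forward proposal with disjoint
  read-closures (the row-89 shape).
* §3 `Gauge.abs_cov_boltzmann_le_of_sqWeight_linkBall` — `SU(n)`, continuous action, proposal of plaquette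
  range `r`, weight typing `e^{-S}/𝒵 = w · q` (the `w · q = π` typing of `TruncatedWilsonFlowSampler`):
  `|Cov_π(A,B)| ≤ 3 √χ a b` beyond `2r`; and the FOOTPRINT LAW `Gauge.exists_mem_linkBall_of_cov_gt_sqWeight`:
  a witness pair above `3 √χ a b` meets within `linkBall (2r)`.

READING (THEORY-1.md §30).  At population ESS fraction `e`, a strictly local range-`r` flow cannot leave target
correlations above `3 √(1/e - 1) · a b` beyond `2r`: `e = 0.99 ⇒ 0.30 ab`, `e = 0.9 ⇒ 1.0 ab` (void), so the
ESS form bites for `e > 0.9`, like THEOREM Q bites for `acc > 5/6` (§28.5).  With target witnesses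
`|Cov| ≥ c e^{-s/ξ}` (an INPUT) the footprint obeys `2r ≥ ξ · log(c / (3 √(1/e - 1)))`.
NOT CLAIMED: any `ξ` value; finite-`N` ESS fluctuations (population quantities only); any converse; anything
extensive in the volume (theory-2's scaling files); the quasi-local `+ 2(ℓ_A b + a ℓ_B) η` version follows
from row 90 §1 once both files are in the tree (not restated here).

References: Lüscher, Commun. Math. Phys. 293 (2010) 899 [Luscher2010Trivializing] §3 (the exact flow and its
Jacobian weight); Ghosal–van der Vaart, Fundamentals of Nonparametric Bayesian Inference (2017), App. B,
Lemma B.1 (distances between densities); population `ESS/N = 1/E_ν[w²]`: Agapiou–Papaspiliopoulos–Sanz-Alonso–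
Stuart, Statist. Sci. 32 (2017) 405, arXiv:1511.06196, §2; rows 86, 88, 89.
-/

namespace Summit.Ventures.LatticeQCDFlow.TrivializingMaps

open MeasureTheory Set
open scoped ENNReal NNReal

/-! ## §1. Second moment of the weight `⟹` dual closeness `⟹` clustering transfer -/

section Abstract

variable {X : Type*} [MeasurableSpace X] {μ : Measure X} {p q w : X → ℝ}

/-- The elementary inequality `|t| ≤ λ t²/2 + 1/(2λ)` for `λ > 0` (from `(λ|t| - 1)² ≥ 0`). [folklore] -/
theorem abs_le_quad {t lam : ℝ} (hlam : 0 < lam) : |t| ≤ lam * t ^ 2 / 2 + 1 / (2 * lam) := by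
  have h : 0 ≤ (lam * |t| - 1) ^ 2 := sq_nonneg _
  rw [sub_sq, mul_pow, sq_abs] at h
  rw [div_add_div _ _ two_ne_zero (by positivity : (2 * lam : ℝ) ≠ 0), le_div_iff₀ (by positivity)]
  nlinarith [h, abs_nonneg t, hlam]

/-- **`L¹` distance from the second moment of the weight.**  If `p = w · q` pointwise (`q ≥ 0`, both unit
mass) and `∫ w² q dμ ≤ 1 + χ`, then `∫ |p - q| dμ ≤ λχ/2 + 1/(2λ)` for every `λ > 0` (at `λ = 1/√χ`: the
classical `χ²`-versus-`L¹` comparison `‖p - q‖₁ ≤ √χ²` with the Cauchy–Schwarz constant; cf. the textbook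
chain `‖p - q‖₁² ≤ 2 K(p;q)`, Ghosal–van der Vaart 2017, Lemma B.1; the `λ`-form proof is ours). -/
theorem integral_abs_sub_le_of_sqWeight (hq0 : ∀ x, 0 ≤ q x) (hqi : Integrable q μ)
    (hq1 : ∫ x, q x ∂μ = 1) (hpi : Integrable p μ) (hp1 : ∫ x, p x ∂μ = 1) (hw : ∀ x, p x = w x * q x)
    (hw2i : Integrable (fun x => w x ^ 2 * q x) μ) {χ : ℝ} (hchi : ∫ x, w x ^ 2 * q x ∂μ ≤ 1 + χ)
    {lam : ℝ} (hlam : 0 < lam) : ∫ x, |p x - q x| ∂μ ≤ lam * χ / 2 + 1 / (2 * lam) := by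
  have hpt : ∀ x, |p x - q x| ≤
      lam / 2 * (w x ^ 2 * q x) - lam * p x + (lam / 2 + 1 / (2 * lam)) * q x := by
    intro x
    have hx : p x - q x = (w x - 1) * q x := by rw [hw x]; ring
    calc |p x - q x| = |w x - 1| * q x := by rw [hx, abs_mul, abs_of_nonneg (hq0 x)]
      _ ≤ (lam * (w x - 1) ^ 2 / 2 + 1 / (2 * lam)) * q x :=
          mul_le_mul_of_nonneg_right (abs_le_quad hlam) (hq0 x)
      _ = lam / 2 * (w x ^ 2 * q x) - lam * p x + (lam / 2 + 1 / (2 * lam)) * q x := by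
          rw [hw x]; ring
  have hi12 : Integrable (fun x => lam / 2 * (w x ^ 2 * q x) - lam * p x) μ :=
    (hw2i.const_mul _).sub (hpi.const_mul _)
  have hi3 : Integrable (fun x => (lam / 2 + 1 / (2 * lam)) * q x) μ := hqi.const_mul _
  calc ∫ x, |p x - q x| ∂μ
      ≤ ∫ x, (lam / 2 * (w x ^ 2 * q x) - lam * p x + (lam / 2 + 1 / (2 * lam)) * q x) ∂μ :=
        integral_mono (hpi.sub hqi).abs (hi12.add hi3) hpt
    _ = lam / 2 * (∫ x, w x ^ 2 * q x ∂μ) - lam * 1 + (lam / 2 + 1 / (2 * lam)) * 1 := by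
        rw [integral_add hi12 hi3, integral_sub (hw2i.const_mul _) (hpi.const_mul _),
          integral_const_mul, integral_const_mul, integral_const_mul, hp1, hq1]
    _ ≤ lam * χ / 2 + 1 / (2 * lam) := by nlinarith [hchi, hlam]

/-- **THE SECOND MOMENT OF THE WEIGHT CERTIFIES DUAL CLOSENESS.**  Target `p·μ`, model `q·μ`, importance
weight `w` with `p = w · q` and `∫ w² q dμ ≤ 1 + χ` (population `ESS/N = 1/(1 + χ)`): for every `λ > 0`,
`p·μ` and `q·μ` are `IntegralClose` with constant `λχ/2 + 1/(2λ)`. [ours] -/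
theorem integralClose_of_sqWeight (hp0 : ∀ x, 0 ≤ p x) (hpm : Measurable p) (hpi : Integrable p μ)
    (hp1 : ∫ x, p x ∂μ = 1) (hq0 : ∀ x, 0 ≤ q x) (hqm : Measurable q) (hqi : Integrable q μ)
    (hq1 : ∫ x, q x ∂μ = 1) (hw : ∀ x, p x = w x * q x) (hw2i : Integrable (fun x => w x ^ 2 * q x) μ)
    {χ : ℝ} (hchi : ∫ x, w x ^ 2 * q x ∂μ ≤ 1 + χ) {lam : ℝ} (hlam : 0 < lam) :
    IntegralClose (μ.withDensity fun x => ENNReal.ofReal (p x))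
      (μ.withDensity fun x => ENNReal.ofReal (q x)) (lam * χ / 2 + 1 / (2 * lam)) :=
  IntegralClose.mono (integral_abs_sub_le_of_sqWeight hq0 hqi hq1 hpi hp1 hw hw2i hchi hlam)
    (integralClose_withDensity hp0 hpm hpi hq0 hqm hqi)

/-- … with the optimal `λ = 1/√χ` (`χ > 0`): constant `√χ = √(N/ESS - 1)`. [ours] -/
theorem integralClose_of_sqWeight_sqrt (hp0 : ∀ x, 0 ≤ p x) (hpm : Measurable p) (hpi : Integrable p μ)
    (hp1 : ∫ x, p x ∂μ = 1) (hq0 : ∀ x, 0 ≤ q x) (hqm : Measurable q) (hqi : Integrable q μ)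
    (hq1 : ∫ x, q x ∂μ = 1) (hw : ∀ x, p x = w x * q x) (hw2i : Integrable (fun x => w x ^ 2 * q x) μ)
    {χ : ℝ} (hchi : ∫ x, w x ^ 2 * q x ∂μ ≤ 1 + χ) (hχ : 0 < χ) :
    IntegralClose (μ.withDensity fun x => ENNReal.ofReal (p x))
      (μ.withDensity fun x => ENNReal.ofReal (q x)) (Real.sqrt χ) := by
  have hs : 0 < Real.sqrt χ := Real.sqrt_pos.2 hχ
  have hsq : Real.sqrt χ * Real.sqrt χ = χ := Real.mul_self_sqrt hχ.le
  have h := integralClose_of_sqWeight hp0 hpm hpi hp1 hq0 hqm hqi hq1 hw hw2i hchi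
    (lam := 1 / Real.sqrt χ) (by positivity)
  have h3 : ∀ s : ℝ, 1 / s * (s * s) / 2 + 1 / (2 * (1 / s)) = s := fun s => by
    rw [one_div_mul_eq_div, mul_self_div_self, mul_one_div, one_div_div]; ring
  have e : 1 / Real.sqrt χ * χ / 2 + 1 / (2 * (1 / Real.sqrt χ)) = Real.sqrt χ := by
    have h4 := h3 (Real.sqrt χ)
    rwa [hsq] at h4
  rwa [e] at h

/-- **ESS `⟹` clustering transfer (abstract).**  If `A`, `B` (`|A| ≤ a`, `|B| ≤ b`, measurable) are exactly
uncorrelated under the model `q·μ` and the weight has `∫ w² q dμ ≤ 1 + χ`, `χ > 0`, then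
`|Cov_π(A, B)| ≤ 3 √χ · a b`. [ours] -/
theorem abs_cov_le_of_sqWeight (hp0 : ∀ x, 0 ≤ p x) (hpm : Measurable p) (hpi : Integrable p μ)
    (hp1 : ∫ x, p x ∂μ = 1) (hq0 : ∀ x, 0 ≤ q x) (hqm : Measurable q) (hqi : Integrable q μ)
    (hq1 : ∫ x, q x ∂μ = 1) (hw : ∀ x, p x = w x * q x) (hw2i : Integrable (fun x => w x ^ 2 * q x) μ)
    {χ : ℝ} (hchi : ∫ x, w x ^ 2 * q x ∂μ ≤ 1 + χ) (hχ : 0 < χ) {A B : X → ℝ} (hAm : Measurable A)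
    (hBm : Measurable B) {a b : ℝ} (hA : ∀ x, |A x| ≤ a) (hB : ∀ x, |B x| ≤ b)
    (hfac : ∫ x, A x * B x ∂(μ.withDensity fun x => ENNReal.ofReal (q x))
      = (∫ x, A x ∂(μ.withDensity fun x => ENNReal.ofReal (q x)))
        * ∫ x, B x ∂(μ.withDensity fun x => ENNReal.ofReal (q x))) :
    |∫ x, A x * B x ∂(μ.withDensity fun x => ENNReal.ofReal (p x))
        - (∫ x, A x ∂(μ.withDensity fun x => ENNReal.ofReal (p x)))
          * ∫ x, B x ∂(μ.withDensity fun x => ENNReal.ofReal (p x))| ≤ 3 * Real.sqrt χ * (a * b) := by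
  haveI := isProbabilityMeasure_withDensity_ofReal hp0 hpi hp1
  haveI := isProbabilityMeasure_withDensity_ofReal hq0 hqi hq1
  exact abs_cov_le_of_integralClose _ _
    (integralClose_of_sqWeight_sqrt hp0 hpm hpi hp1 hq0 hqm hqi hq1 hw hw2i hchi hχ) hAm hBm hA hB hfac

end Abstract

/-! ## §2. Product base law, push-forward proposal, disjoint read-closures -/

section ReadClosure

variable {ι : Type*} [Fintype ι] {α : Type*} [MeasurableSpace α]
variable (μ₀ : Measure α) [IsProbabilityMeasure μ₀]

/-- **THEOREM Q-ESS, read-closure form.**  Base law `μ₀^ι`, proposal `Φ` (measurable, output `i` reads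
`N i`) with push-forward density `q`, target density `p = w · q` with `∫ w² q ≤ 1 + χ`, `χ > 0`; observables
on `S`, `T` with disjoint read-closures: `|Cov_{p·μ₀^ι}(A, B)| ≤ 3 √χ a b`. [ours] -/
theorem abs_cov_le_of_sqWeight_of_disjoint {p q w : (ι → α) → ℝ} (hp0 : ∀ x, 0 ≤ p x)
    (hpm : Measurable p) (hpi : Integrable p (Measure.pi fun _ : ι => μ₀))
    (hp1 : ∫ x, p x ∂(Measure.pi fun _ : ι => μ₀) = 1) (hq0 : ∀ x, 0 ≤ q x) (hqm : Measurable q)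
    (hqi : Integrable q (Measure.pi fun _ : ι => μ₀))
    (hq1 : ∫ x, q x ∂(Measure.pi fun _ : ι => μ₀) = 1) (hw : ∀ x, p x = w x * q x)
    (hw2i : Integrable (fun x => w x ^ 2 * q x) (Measure.pi fun _ : ι => μ₀)) {χ : ℝ}
    (hchi : ∫ x, w x ^ 2 * q x ∂(Measure.pi fun _ : ι => μ₀) ≤ 1 + χ) (hχ : 0 < χ)
    {Φ : (ι → α) → (ι → α)} (hΦm : Measurable Φ)
    (hν : (Measure.pi fun _ : ι => μ₀).map Φ
      = (Measure.pi fun _ : ι => μ₀).withDensity fun x => ENNReal.ofReal (q x))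
    {N : ι → Set ι} (hΦ : ∀ i, DependsOn (fun W => Φ W i) (N i))
    {A B : (ι → α) → ℝ} (hAm : Measurable A) (hBm : Measurable B) {a b : ℝ} (hAa : ∀ x, |A x| ≤ a)
    (hBb : ∀ x, |B x| ≤ b) {S T : Set ι} (hA : DependsOn A S) (hB : DependsOn B T)
    (hdisj : Disjoint (readClosure N S) (readClosure N T)) :
    |∫ U, A U * B U ∂((Measure.pi fun _ : ι => μ₀).withDensity fun x => ENNReal.ofReal (p x))
        - (∫ U, A U ∂((Measure.pi fun _ : ι => μ₀).withDensity fun x => ENNReal.ofReal (p x)))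
          * ∫ U, B U ∂((Measure.pi fun _ : ι => μ₀).withDensity fun x => ENNReal.ofReal (p x))|
      ≤ 3 * Real.sqrt χ * (a * b) := by
  have hfac := pushforward_integral_mul_eq μ₀ hΦm hΦ hAm hBm hA hB hdisj
  rw [hν] at hfac
  exact abs_cov_le_of_sqWeight hp0 hpm hpi hp1 hq0 hqm hqi hq1 hw hw2i hchi hχ hAm hBm hAa hBb hfac

end ReadClosure

/-! ## §3. `SU(n)` lattice gauge theory: plaquette-ball range, Boltzmann target, weight typing -/

namespace Gauge

open Literature.MathematicalPhysics.QuantumFieldTheory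
open Literature.MathematicalPhysics.QuantumFieldTheory.Luscher2010

variable {d L n : ℕ} [NeZero L]

/-- **THEOREM Q-ESS for lattice gauge theory.**  `G = SU(n)`, continuous action `S`, target
`π = 𝒵⁻¹ e^{-S} D[U]`; a measurable proposal map `Φ` of plaquette RANGE `r` whose push-forward `Φ_* D[V]`
has density `q ≥ 0`; an importance weight `w` with `e^{-S}/𝒵 = w · q` pointwise and second moment
`∫ w² q D[U] ≤ 1 + χ`, `χ > 0` (population `ESS/N = 1/(1 + χ)`).  Then for all measurable `|A| ≤ a`,
`|B| ≤ b` depending on link sets `SA`, `SB` with `e' ∉ linkBall (2r) e`: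
`|⟨A B⟩ - ⟨A⟩⟨B⟩| ≤ 3 √χ · a b` (expectations in `π`). [ours] -/
theorem abs_cov_boltzmann_le_of_sqWeight_linkBall
    {S : GaugeConfig d L (Matrix.specialUnitaryGroup (Fin n) ℂ) → ℝ} (hS : Continuous S)
    {Φ : GaugeConfig d L (Matrix.specialUnitaryGroup (Fin n) ℂ) →
      GaugeConfig d L (Matrix.specialUnitaryGroup (Fin n) ℂ)} (hΦm : Measurable Φ)
    {q w : GaugeConfig d L (Matrix.specialUnitaryGroup (Fin n) ℂ) → ℝ} (hq0 : ∀ U, 0 ≤ q U)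
    (hqm : Measurable q)
    (hν : (trivialMeasure (Matrix.specialUnitaryGroup (Fin n) ℂ) d L).map Φ
      = (trivialMeasure (Matrix.specialUnitaryGroup (Fin n) ℂ) d L).withDensity
          fun U => ENNReal.ofReal (q U))
    (hw : ∀ U, Real.exp (-S U) / (partitionFn S).toReal = w U * q U)
    (hw2i : Integrable (fun U => w U ^ 2 * q U) (trivialMeasure (Matrix.specialUnitaryGroup (Fin n) ℂ) d L))
    {χ : ℝ}
    (hchi : ∫ U, w U ^ 2 * q U ∂(trivialMeasure (Matrix.specialUnitaryGroup (Fin n) ℂ) d L) ≤ 1 + χ)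
    (hχ : 0 < χ) {r : ℕ} (hΦ : ∀ e, DependsOn (fun W => Φ W e) (linkBall r e))
    {A B : GaugeConfig d L (Matrix.specialUnitaryGroup (Fin n) ℂ) → ℝ} (hAm : Measurable A)
    (hBm : Measurable B) {a b : ℝ} (hAa : ∀ U, |A U| ≤ a) (hBb : ∀ U, |B U| ≤ b)
    {SA SB : Set (Edge d L)} (hA : DependsOn A SA) (hB : DependsOn B SB)
    (hsep : ∀ e ∈ SA, ∀ e' ∈ SB, e' ∉ linkBall (2 * r) e) :
    |∫ U, A U * B U ∂(boltzmannMeasure S)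
        - (∫ U, A U ∂(boltzmannMeasure S)) * ∫ U, B U ∂(boltzmannMeasure S)|
      ≤ 3 * Real.sqrt χ * (a * b) := by
  obtain ⟨hp0, hpm, hpi, hp1⟩ := density_boltzmann_spec (d := d) (L := L) hS
  obtain ⟨hqi, hq1⟩ := integrable_of_map_eq_withDensity (d := d) (L := L) hΦm hq0 hqm hν
  rw [boltzmannMeasure_eq_withDensity hS]
  unfold trivialMeasure at hpi hp1 hqi hq1 hν hw2i hchi ⊢
  exact abs_cov_le_of_sqWeight_of_disjoint (haarProbability (Matrix.specialUnitaryGroup (Fin n) ℂ))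
    hp0 hpm hpi hp1 hq0 hqm hqi hq1 hw hw2i hchi hχ hΦm hν hΦ hAm hBm hAa hBb hA hB
    (disjoint_readClosure_linkBall hsep)

/-- **FOOTPRINT LAW (ESS form).**  Same setting: a witness pair with `|Cov_π(A, B)| > 3 √χ a b` has
supports meeting within `linkBall (2r)` — the range of a strictly local flow with population `ESS/N = e` is at
least half the plaquette distance of every target witness pair above `3 √(1/e - 1) a b`. [ours] -/
theorem exists_mem_linkBall_of_cov_gt_sqWeight
    {S : GaugeConfig d L (Matrix.specialUnitaryGroup (Fin n) ℂ) → ℝ} (hS : Continuous S)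
    {Φ : GaugeConfig d L (Matrix.specialUnitaryGroup (Fin n) ℂ) →
      GaugeConfig d L (Matrix.specialUnitaryGroup (Fin n) ℂ)} (hΦm : Measurable Φ)
    {q w : GaugeConfig d L (Matrix.specialUnitaryGroup (Fin n) ℂ) → ℝ} (hq0 : ∀ U, 0 ≤ q U)
    (hqm : Measurable q)
    (hν : (trivialMeasure (Matrix.specialUnitaryGroup (Fin n) ℂ) d L).map Φ
      = (trivialMeasure (Matrix.specialUnitaryGroup (Fin n) ℂ) d L).withDensity
          fun U => ENNReal.ofReal (q U))
    (hw : ∀ U, Real.exp (-S U) / (partitionFn S).toReal = w U * q U)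
    (hw2i : Integrable (fun U => w U ^ 2 * q U) (trivialMeasure (Matrix.specialUnitaryGroup (Fin n) ℂ) d L))
    {χ : ℝ}
    (hchi : ∫ U, w U ^ 2 * q U ∂(trivialMeasure (Matrix.specialUnitaryGroup (Fin n) ℂ) d L) ≤ 1 + χ)
    (hχ : 0 < χ) {r : ℕ} (hΦ : ∀ e, DependsOn (fun W => Φ W e) (linkBall r e))
    {A B : GaugeConfig d L (Matrix.specialUnitaryGroup (Fin n) ℂ) → ℝ} (hAm : Measurable A)
    (hBm : Measurable B) {a b : ℝ} (hAa : ∀ U, |A U| ≤ a) (hBb : ∀ U, |B U| ≤ b)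
    {SA SB : Set (Edge d L)} (hA : DependsOn A SA) (hB : DependsOn B SB)
    (hcov : 3 * Real.sqrt χ * (a * b) < |∫ U, A U * B U ∂(boltzmannMeasure S)
        - (∫ U, A U ∂(boltzmannMeasure S)) * ∫ U, B U ∂(boltzmannMeasure S)|) :
    ∃ e ∈ SA, ∃ e' ∈ SB, e' ∈ linkBall (2 * r) e := by
  by_contra h
  push Not at h
  exact absurd (abs_cov_boltzmann_le_of_sqWeight_linkBall hS hΦm hq0 hqm hν hw hw2i hchi hχ hΦ hAm hBm
    hAa hBb hA hB h) (not_le.2 hcov)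

end Gauge

end Summit.Ventures.LatticeQCDFlow.TrivializingMaps
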